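import Summits.Ventures.CertifiedQuantumChemistry.Rows.CIUpperBound
import HarnessLib

/-!
# Ventures/CertifiedQuantumChemistry — Rows/SlaterCondonSelectionRule.lean: the abelian point-group SELECTION RULE for the
# kernel's Slater–Condon matrix (symmetry-blocked sector matrices without evaluating the cross-block elements)

HONEST FRAMING (verbatim): certified bounds for a stated model Hamiltonian in a stated basis; not a
claim about the real molecule beyond that model.

var-2 (gen 15), zero compute, PROVED glue only (0 sorry, no definition, no claim node; nothing here asserts a bound about
any model). Every certificate class of the cell that works on the occupation-basis block of `H_F` (var-1's
`qc-lower-chol-v0`, the kernel CI / Gram files) blocks that matrix by the irreducible representations of an ABELIAN point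
group (D2h and subgroups: all characters `±1`). In the kernel the blocking must be JUSTIFIED: the matrix element between
determinants of different symmetry vanishes. Evaluating `Model.slaterCondon` on all cross-block pairs costs as much as the
blocks themselves; this file proves the selection rule ONCE, generically, from two decidable properties of the integral
TABLES. Labels live in any additive commutative group `G` (for D2h: `(ZMod 2)³`; for the `C_i`/inversion parity of a
linear chain in a minimal basis: `ZMod 2 = Fin 2`), `l : Fin k → G` labels the spatial orbitals, a spin orbital carries the
label of its spatial part, and an occupation set `I` the sum `Σ_{P ∈ I} l P`:

* `Model.h1_eq_zero_of_label_ne`, `Model.g2_eq_zero_of_label_ne` — if `h_pq ≠ 0 ⇒ l p = l q` and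
  `(pq|rs) ≠ 0 ⇒ l p + l r = l q + l s` (for real orbitals and `±1` characters this is the usual "the product of the four
  irreps contains the trivial one"), the spin-orbital integrals inherit the rule;
* `Model.scSingle_eq_zero_of_label_ne`, `Model.scDouble_eq_zero_of_label_ne` — the one- and two-replacement formulas
  vanish when the replaced orbitals carry a different total label than the replacing ones (term by term: every integral in
  HJO (1.4.35) / (1.4.24) violates the rule);
* **`Model.slaterCondon_eq_zero_of_label_ne`** — hence `⟨I|H_F|J⟩ = 0` whenever `Σ_{P∈I} l P ≠ Σ_{P∈J} l P`: the
  sector matrix is block diagonal by determinant label, for EVERY model whose tables pass the two decidable checks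
  (`decide` over `k²` and `k⁴` table entries on a literal model).

First use: `Certificates/H6Sto6gR1786KernelLower*.lean` (H₆/STO-6G, ORBSYM `[Ag,B1u,Ag,B1u,Ag,B1u]`, labels `p mod 2`; the
`(3,3)` sector splits `400 = 200 + 200`). Reference: Helgaker–Jørgensen–Olsen, *Molecular Electronic-Structure Theory*
(2000) §1.4 (Slater–Condon rules; the tree's `QuantumChemistry/SlaterCondonRules*.lean`) with the elementary symmetry
argument of e.g. Szabo–Ostlund §4.4 / Cotton, *Chemical Applications of Group Theory* §5 (vanishing integrals).
-/

namespace Summit.Ventures.CertifiedQuantumChemistry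

open Finset
open Literature.MathematicalPhysics.QuantumLattice Literature.MathematicalPhysics.QuantumChemistry

namespace Model

variable {k : ℕ} {G : Type*} [AddCommGroup G]

omit [AddCommGroup G] in
/-- The spin-orbital one-electron integral obeys the selection rule of the spatial table. -/
theorem h1_eq_zero_of_label_ne (F : Model k) (l : Fin k → G) (hh : ∀ p q, F.h p q ≠ 0 → l p = l q)
    {P Q : Orb (Fin k)} (hPQ : l (ofLex P).1 ≠ l (ofLex Q).1) : F.h1 P Q = 0 := by
  unfold h1
  split_ifs with hs
  · by_contra hne
    exact hPQ (hh _ _ hne)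
  · rfl

/-- The spin-orbital two-electron integral obeys the selection rule of the spatial table:
`g_{PQRS} ≠ 0 ⇒ l P + l R = l Q + l S`. -/
theorem g2_eq_zero_of_label_ne (F : Model k) (l : Fin k → G)
    (he : ∀ p q r s, F.eri p q r s ≠ 0 → l p + l r = l q + l s) {P Q R S : Orb (Fin k)}
    (h : l (ofLex P).1 + l (ofLex R).1 ≠ l (ofLex Q).1 + l (ofLex S).1) : F.g2 P Q R S = 0 := by
  unfold g2
  split_ifs with hs
  · by_contra hne
    exact h (he _ _ _ _ hne)
  · rfl

/-- One replacement `b → a` with `l a ≠ l b`: every integral of the four-sum formula `scSingle` violates the rule. -/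
theorem scSingle_eq_zero_of_label_ne (F : Model k) (l : Fin k → G) (hh : ∀ p q, F.h p q ≠ 0 → l p = l q)
    (he : ∀ p q r s, F.eri p q r s ≠ 0 → l p + l r = l q + l s) (J : Finset (Orb (Fin k)))
    {a b : Orb (Fin k)} (hab : l (ofLex a).1 ≠ l (ofLex b).1) : F.scSingle J a b = 0 := by
  unfold scSingle
  have h0 : F.h1 a b = 0 := h1_eq_zero_of_label_ne F l hh hab
  have hsum : ∑ R ∈ J, ((F.g2 a b R R + F.g2 R R a b) - (F.g2 a R R b + F.g2 R b a R)) = 0 := by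
    refine Finset.sum_eq_zero fun R _ => ?_
    have e1 : F.g2 a b R R = 0 :=
      g2_eq_zero_of_label_ne F l he fun h => hab (add_right_cancel h)
    have e2 : F.g2 R R a b = 0 :=
      g2_eq_zero_of_label_ne F l he fun h => hab (add_left_cancel h)
    have e3 : F.g2 a R R b = 0 :=
      g2_eq_zero_of_label_ne F l he fun h => hab (add_right_cancel (h.trans (add_comm _ _)))
    have e4 : F.g2 R b a R = 0 :=
      g2_eq_zero_of_label_ne F l he fun h => hab (add_left_cancel (h.trans (add_comm _ _)))
    rw [e1, e2, e3, e4]; ring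
  rw [h0, hsum]; ring

/-- Two replacements `K, L → I, J` with `l I + l J ≠ l K + l L`: every integral of `scDouble` violates the rule. -/
theorem scDouble_eq_zero_of_label_ne (F : Model k) (l : Fin k → G)
    (he : ∀ p q r s, F.eri p q r s ≠ 0 → l p + l r = l q + l s) (D : Finset (Orb (Fin k)))
    {I J K L : Orb (Fin k)}
    (h : l (ofLex I).1 + l (ofLex J).1 ≠ l (ofLex K).1 + l (ofLex L).1) : F.scDouble D I J K L = 0 := by
  unfold scDouble
  have e1 : F.g2 I K J L = 0 := g2_eq_zero_of_label_ne F l he h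
  have e2 : F.g2 I L J K = 0 := g2_eq_zero_of_label_ne F l he fun h' => h (h'.trans (add_comm _ _))
  have e3 : F.g2 J K I L = 0 := g2_eq_zero_of_label_ne F l he fun h' => h ((add_comm _ _).trans h')
  have e4 : F.g2 J L I K = 0 :=
    g2_eq_zero_of_label_ne F l he fun h' => h (((add_comm _ _).trans h').trans (add_comm _ _))
  rw [e1, e2, e3, e4]; ring

/-- A two-element set sums over its `min'` and `max'`. -/
theorem sum_eq_min'_add_max' {M : Type*} [AddCommMonoid M] {s : Finset (Orb (Fin k))} (hs : s.card = 2)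
    (hne : s.Nonempty) (f : Orb (Fin k) → M) : ∑ P ∈ s, f P = f (s.min' hne) + f (s.max' hne) := by
  have hlt := Finset.min'_lt_max'_of_card s (by omega)
  calc ∑ P ∈ s, f P = ∑ P ∈ ({s.min' hne, s.max' hne} : Finset (Orb (Fin k))), f P := by
        rw [← eq_pair_min'_max' hs hne]
    _ = f (s.min' hne) + f (s.max' hne) := Finset.sum_pair hlt.ne

/-- **THE SELECTION RULE.** If the one-electron table satisfies `h_pq ≠ 0 ⇒ l p = l q` and the two-electron table
`(pq|rs) ≠ 0 ⇒ l p + l r = l q + l s`, then the Slater–Condon matrix element between occupation sets of different total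
label vanishes: `Σ_{P∈I} l P ≠ Σ_{P∈J} l P ⇒ ⟨I|H_F|J⟩ = 0`. -/
theorem slaterCondon_eq_zero_of_label_ne (F : Model k) (l : Fin k → G) (hh : ∀ p q, F.h p q ≠ 0 → l p = l q)
    (he : ∀ p q r s, F.eri p q r s ≠ 0 → l p + l r = l q + l s) {I J : Finset (Orb (Fin k))}
    (hIJ : ∑ P ∈ I, l (ofLex P).1 ≠ ∑ P ∈ J, l (ofLex P).1) : F.slaterCondon I J = 0 := by
  -- the label difference lives on the set differences
  have hsplit : ∀ A B : Finset (Orb (Fin k)),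
      ∑ P ∈ A, l (ofLex P).1 = ∑ P ∈ A ∩ B, l (ofLex P).1 + ∑ P ∈ A \ B, l (ofLex P).1 :=
    fun A B => (Finset.sum_inter_add_sum_sdiff A B _).symm
  have hdiff : ∑ P ∈ I \ J, l (ofLex P).1 ≠ ∑ P ∈ J \ I, l (ofLex P).1 := by
    intro h
    apply hIJ
    rw [hsplit I J, hsplit J I, Finset.inter_comm J I, h]
  unfold slaterCondon
  by_cases hIJ0 : I = J
  · exact absurd (by rw [hIJ0]) hIJ
  rw [if_neg hIJ0]
  by_cases h1 : I.card = J.card ∧ (J \ I).card = 1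
  · rw [if_pos h1]
    have he' : (I \ J).card = 1 := by rw [card_sdiff_eq_card_sdiff h1.1]; exact h1.2
    obtain ⟨b, hb⟩ := Finset.card_eq_one.1 h1.2
    obtain ⟨a, ha⟩ := Finset.card_eq_one.1 he'
    rw [ha, hb, Finset.sum_singleton, Finset.sum_singleton]
    refine scSingle_eq_zero_of_label_ne F l hh he J fun hab => hdiff ?_
    rw [ha, hb, Finset.sum_singleton, Finset.sum_singleton, hab]
  rw [if_neg h1]
  by_cases h2 : 1 < (J \ I).card ∧ 1 < (I \ J).card ∧ (J \ I).card = 2 ∧ I.card = J.card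
  · rw [dif_pos h2]
    have hcI : (I \ J).card = 2 := by rw [card_sdiff_eq_card_sdiff h2.2.2.2]; exact h2.2.2.1
    refine scDouble_eq_zero_of_label_ne F l he J fun hs => hdiff ?_
    rw [sum_eq_min'_add_max' hcI (card_pos.1 (by omega)), sum_eq_min'_add_max' h2.2.2.1 (card_pos.1 (by omega)), hs]
  · rw [dif_neg h2]

end Model

end Summit.Ventures.CertifiedQuantumChemistry
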